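import Summits.ValiantsHypothesis.ValiantsHypothesis.Theorems.KPlusLogSqLawTropicalBSingleGaugeExists

/-!
# Route «KPlusLogSqLaw», crux `WeakLifting` (stmt-ValiantsHypothesis-19561), docket D2 — the BIRKHOFF-FACE POTENTIAL LEMMA:
# an integer weight that is constant on all permutations supported in a position pattern is a ROW + COLUMN POTENTIAL on every
# position the supported permutations use

HONEST FRAMING.  Helper file (cell `pub-symmetroid`, seat val-sym-lift-p3 g25, 2026-08-29) `--supports` the crux
`Summit.ValiantsHypothesis.ValiantsHypothesis.Theses.KPlusLogSqLaw.WeakLifting` (ledger item `stmt-ValiantsHypothesis-19561`, route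
`KPlusLogSqLaw`; lineage docket D2 = the `K = 4` tropical exponent fork).  A pure combinatorial lemma about permutations of `Fin m`; it is
the input that turns the lineage's LEX TOP-CLASS RIGIDITY (`TropicalCensus.classCount_eq_of_recombination`, p494347: every perfect
matching of the union support of a strongly-lex page carries the page's top count) into GRADED PAGES (the top class of a page sits on an
integer row/column grading — requirement R3 of HOME/val-sym-lift-p3/g4/K4-PAGE-RIGIDITY-AND-CARRIES.md §3–4; companion file).  Nothing here
asserts or bounds `WeakLifting`, `TropicalB`, `Lifting`, `KPlusLogSqLaw`, `MatrixDescartes` (stmt-ValiantsHypothesis-18050) or VP ≠ VNP.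

THE LEMMA (`exists_potential_of_sum_const`).  Let `P : Fin m → Fin m → Prop` be a pattern of positions (row, column) and
`w : Fin m → Fin m → ℤ` a weight.  Call a permutation `σ` SUPPORTED if `P (σ i) i` for every column `i`.  If some permutation is supported
and `Σ_i w (σ i) i` takes the same value on all supported `σ`, then there are integer potentials `α β : Fin m → ℤ` with
`w (σ i) i = α (σ i) + β i` for every supported `σ` and every column `i` — i.e. `w` is a potential on every position used by a supported
permutation (the matching-covered part of the pattern).  Equivalently: a linear functional that is constant on a face of the Birkhoff
polytope is, on the support of that face, a sum of row and column functionals.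

PROOF (no matching theory).  Reduce to the case where the identity is supported (`exists_potential_of_sum_const_id`; relabel the rows by a
supported `σ₀`).  Put on the complete digraph on `Fin m` the arc weights `a i j = w j i − w i i` if `P j i` ("column `i` takes row `j`")
and `a i j = −B` otherwise, `B = m·M + 1`, `M = Σ |w j i − w i i|`.  A cycle through distinct vertices `v₀ → ⋯ → vₙ → v₀` with all arcs
in the pattern IS a supported permutation (the cyclic permutation `List.formPerm` of the tuple, identity elsewhere — `formPerm_ofFn_apply`,
`formPerm_ofFn_of_not_mem_range`), so its weight is `w(cycle) − w(id) = 0`; a cycle with an arc outside the pattern weighs `≤ −B + n·M < 0`.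
Hence the tree's Bellman–Ford lemma `SingleGauge.exists_addPotential` gives `e` with `e j + a i j ≤ e i`; on a supported `σ` the
inequalities `w (σ i) i − w i i ≤ e i − e (σ i)` sum over `i` to `0 ≤ 0` (constancy + `Σ e (σ i) = Σ e i`), so each is an equality:
`α = −e`, `β i = w i i + e i`.  [folklore: LP duality / the affine hull of a face of the Birkhoff polytope is cut out by row sums, column sums
and vanishing coordinates; the packaging over `IsDominant`-free permutation data is the cell's]
-/

set_option linter.dupNamespace false
set_option autoImplicit false

namespace Summit.ValiantsHypothesis.ValiantsHypothesis.Theorems.KPlusLogSqLaw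

open scoped BigOperators
open Finset

namespace BirkhoffFace

variable {m : ℕ}

/-- The cyclic permutation of an injective tuple sends `v t` to `v (t + 1)` (index addition in `Fin (n+1)`). [folklore] -/
theorem formPerm_ofFn_apply {n : ℕ} (v : Fin (n + 1) → Fin m) (hv : Function.Injective v) (t : Fin (n + 1)) :
    (List.ofFn v).formPerm (v t) = v (t + 1) := by
  have hnd : (List.ofFn v).Nodup := List.nodup_ofFn.mpr hv
  have ht : (t : ℕ) < (List.ofFn v).length := by rw [List.length_ofFn]; exact t.isLt
  have h1 : (List.ofFn v)[(t : ℕ)]'ht = v t := by rw [List.getElem_ofFn]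
  rw [← h1, List.formPerm_apply_getElem _ hnd, List.getElem_ofFn]
  congr 1
  apply Fin.ext
  simp only [Fin.val_add, Fin.val_one', Nat.add_mod_mod, List.length_ofFn]

/-- The cyclic permutation of a tuple fixes everything off the tuple's range. [folklore] -/
theorem formPerm_ofFn_of_not_mem_range {n : ℕ} (v : Fin (n + 1) → Fin m) (i : Fin m) (hi : i ∉ Set.range v) :
    (List.ofFn v).formPerm i = i :=
  List.formPerm_apply_of_notMem (fun h => hi ((List.mem_ofFn' v i).mp h))

/-- **Birkhoff-face potential lemma, identity-supported form.**  If the identity is supported in the pattern `P` and `Σ_i w (σ i) i = Σ_i w i i`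
for every supported permutation `σ`, then `w (σ i) i = α (σ i) + β i` on every supported `σ` for suitable integer potentials. [folklore] -/
theorem exists_potential_of_sum_const_id (P : Fin m → Fin m → Prop) (w : Fin m → Fin m → ℤ)
    (hid : ∀ i, P i i)
    (hconst : ∀ σ : Equiv.Perm (Fin m), (∀ i, P (σ i) i) → ∑ i, w (σ i) i = ∑ i, w i i) :
    ∃ α β : Fin m → ℤ, ∀ σ : Equiv.Perm (Fin m), (∀ i, P (σ i) i) → ∀ i, w (σ i) i = α (σ i) + β i := by
  classical
  -- arc weights on the complete digraph: column `i` takes row `j`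
  set M : ℤ := ∑ i, ∑ j, |w j i - w i i| with hM
  set B : ℤ := (m : ℤ) * M + 1 with hB
  let a : Fin m → Fin m → ℤ := fun i j => if P j i then w j i - w i i else -B
  have hM0 : 0 ≤ M := sum_nonneg fun i _ => sum_nonneg fun j _ => abs_nonneg _
  have ha_le : ∀ i j, a i j ≤ M := by
    intro i j
    simp only [a]
    split_ifs with h
    · calc w j i - w i i ≤ |w j i - w i i| := le_abs_self _
        _ ≤ ∑ j', |w j' i - w i i| :=
            single_le_sum (f := fun j' => |w j' i - w i i|) (fun _ _ => abs_nonneg _) (mem_univ j)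
        _ ≤ M := single_le_sum (f := fun i' => ∑ j', |w j' i' - w i' i'|)
            (fun _ _ => sum_nonneg fun _ _ => abs_nonneg _) (mem_univ i)
    · have : 0 ≤ (m : ℤ) * M := mul_nonneg (Nat.cast_nonneg m) hM0
      linarith
  -- every cycle through distinct vertices weighs `≤ 0`
  have hcyc : ∀ (n : ℕ) (v : Fin (n + 1) → Fin m), Function.Injective v →
      ∑ t : Fin (n + 1), a (v t) (v (t + 1)) ≤ 0 := by
    intro n v hv
    by_cases hall : ∀ t, P (v (t + 1)) (v t)
    · -- the cyclic permutation of the tuple is supported, so its weight equals the identity's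
      let τ : Equiv.Perm (Fin m) := (List.ofFn v).formPerm
      have hτv : ∀ t, τ (v t) = v (t + 1) := fun t => formPerm_ofFn_apply v hv t
      have hτoff : ∀ i, i ∉ Set.range v → τ i = i := fun i hi => formPerm_ofFn_of_not_mem_range v i hi
      have hsupp : ∀ i, P (τ i) i := by
        intro i
        by_cases hi : i ∈ Set.range v
        · obtain ⟨t, rfl⟩ := hi
          rw [hτv]; exact hall t
        · rw [hτoff i hi]; exact hid i
      have h0 : ∑ i, (w (τ i) i - w i i) = 0 := by
        rw [sum_sub_distrib, hconst τ hsupp, sub_self]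
      have h1 : ∑ i, (w (τ i) i - w i i) = ∑ t, a (v t) (v (t + 1)) := by
        rw [← sum_add_sum_compl (univ.image v) (fun i => w (τ i) i - w i i)]
        have hoff : ∑ i ∈ (univ.image v)ᶜ, (w (τ i) i - w i i) = 0 := by
          refine sum_eq_zero fun i hi => ?_
          have hi' : i ∉ Set.range v := by
            intro hr
            obtain ⟨t, rfl⟩ := hr
            exact (mem_compl.mp hi) (mem_image_of_mem v (mem_univ t))
          rw [hτoff i hi', sub_self]
        rw [hoff, add_zero, sum_image (fun x _ y _ hxy => hv hxy)]
        refine sum_congr rfl fun t _ => ?_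
        simp only [a, if_pos (hall t), hτv]
      rw [← h1, h0]
    · push Not at hall
      obtain ⟨t₀, ht₀⟩ := hall
      have h1 : a (v t₀) (v (t₀ + 1)) = -B := by simp only [a, if_neg ht₀]
      have h2 : ∑ t ∈ univ.erase t₀, a (v t) (v (t + 1)) ≤ (n : ℤ) * M := by
        calc ∑ t ∈ univ.erase t₀, a (v t) (v (t + 1)) ≤ ∑ _t ∈ univ.erase t₀, M :=
              sum_le_sum fun t _ => ha_le _ _
          _ = (n : ℤ) * M := by
              rw [sum_const, card_erase_of_mem (mem_univ _), card_univ, Fintype.card_fin, Nat.add_sub_cancel,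
                nsmul_eq_mul]
      have h3 : (n : ℤ) + 1 ≤ m := by
        have := Fintype.card_le_of_injective v hv
        simp only [Fintype.card_fin] at this
        exact_mod_cast this
      rw [← sum_erase_add _ _ (mem_univ t₀), h1]
      nlinarith
  obtain ⟨e, he⟩ := SingleGauge.exists_addPotential a hcyc
  refine ⟨fun j => -e j, fun i => w i i + e i, fun σ hσ => ?_⟩
  have hle : ∀ i, w (σ i) i - w i i ≤ e i - e (σ i) := by
    intro i
    have h := he i (σ i)
    simp only [a, if_pos (hσ i)] at h
    linarith
  have hsum0 : ∑ i, ((e i - e (σ i)) - (w (σ i) i - w i i)) = 0 := by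
    rw [sum_sub_distrib, sum_sub_distrib, sum_sub_distrib, Equiv.sum_comp σ e, hconst σ hσ]
    ring
  have heach := (sum_eq_zero_iff_of_nonneg (fun i _ => sub_nonneg.mpr (hle i))).mp hsum0
  intro i
  have := heach i (mem_univ i)
  linarith

/-- **Birkhoff-face potential lemma.**  Let `P` be a pattern of positions with at least one supported permutation `σ₀`
(`P (σ₀ i) i` for all `i`), and let the weight `Σ_i w (σ i) i` be the same for all supported permutations `σ`.  Then there are integer
potentials `α β` with `w (σ i) i = α (σ i) + β i` for every supported `σ` and every `i`: the weight is a row + column potential on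
every position used by a supported permutation. [folklore] -/
theorem exists_potential_of_sum_const (P : Fin m → Fin m → Prop) (w : Fin m → Fin m → ℤ)
    (σ₀ : Equiv.Perm (Fin m)) (hσ₀ : ∀ i, P (σ₀ i) i)
    (hconst : ∀ σ : Equiv.Perm (Fin m), (∀ i, P (σ i) i) → ∑ i, w (σ i) i = ∑ i, w (σ₀ i) i) :
    ∃ α β : Fin m → ℤ, ∀ σ : Equiv.Perm (Fin m), (∀ i, P (σ i) i) → ∀ i, w (σ i) i = α (σ i) + β i := by
  -- relabel the rows by `σ₀`
  let P' : Fin m → Fin m → Prop := fun j i => P (σ₀ j) i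
  let w' : Fin m → Fin m → ℤ := fun j i => w (σ₀ j) i
  have hid' : ∀ i, P' i i := hσ₀
  have hconst' : ∀ σ : Equiv.Perm (Fin m), (∀ i, P' (σ i) i) → ∑ i, w' (σ i) i = ∑ i, w' i i := by
    intro σ hσ
    have h := hconst (σ.trans σ₀) (fun i => by simpa [P'] using hσ i)
    simpa [w'] using h
  obtain ⟨α', β, h⟩ := exists_potential_of_sum_const_id P' w' hid' hconst'
  refine ⟨fun a => α' (σ₀.symm a), β, fun σ hσ i => ?_⟩
  have hσ' : ∀ i, P' ((σ.trans σ₀.symm) i) i := fun i => by simpa [P'] using hσ i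
  have := h (σ.trans σ₀.symm) hσ' i
  simpa [w'] using this

/-- **Corollary (constancy is equivalent to being a potential).**  Conversely a row + column potential is constant on supported
permutations; so under the hypotheses of `exists_potential_of_sum_const` the weight of EVERY supported permutation is `Σ α + Σ β`. [folklore] -/
theorem sum_eq_of_potential (P : Fin m → Fin m → Prop) (w : Fin m → Fin m → ℤ) (α β : Fin m → ℤ)
    (h : ∀ σ : Equiv.Perm (Fin m), (∀ i, P (σ i) i) → ∀ i, w (σ i) i = α (σ i) + β i)
    (σ : Equiv.Perm (Fin m)) (hσ : ∀ i, P (σ i) i) : ∑ i, w (σ i) i = ∑ i, α i + ∑ i, β i := by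
  rw [← Equiv.sum_comp σ α, ← sum_add_distrib]
  exact sum_congr rfl fun i _ => h σ hσ i

end BirkhoffFace

end Summit.ValiantsHypothesis.ValiantsHypothesis.Theorems.KPlusLogSqLaw
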